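import Summits.BirchSwinnertonDyer.BirchSwinnertonDyer.Theses.TangentCone
import Summits.BirchSwinnertonDyer.BirchSwinnertonDyer.Theorems.LeadingTermPinchPrimeOrderEqRankOfSchneiderShaAt
import Literature.NumberTheory.EllipticCurves.CanonicalPAdicHeightHolds
import Literature.NumberTheory.EllipticCurves.PAdicLFunction
import Literature.NumberTheory.EllipticCurves.CuspFormLFunction
import HarnessLib

/-!
# Crux `EdgeDecay` (stmt-BirchSwinnertonDyer-17608) — line `ub-schneider-squeeze` (v6)

Crux-strategist line (unit `cstrat-stmt-BirchSwinnertonDyer-17608-b1`; card `Lines/ub_schneider_squeeze.md`,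
census `STRATEGY-CENSUS.md`). The crux — edge critical-value ratios of the Hida branch through `f_E` decay
`p`-adically at rate `≤ r_an` along some slope at ONE admissible prime (Greenberg–Stevens total order
`n_p ≤ r_an`) — is squeezed onto SEVEN registered stubs, of which three are existing ledger conjectures
VERBATIM, two are named Literature facts (printed theorems) resp. modularity, and two are genuine work:

* `stub_admissibleSupply` (theorem-grade, M/L): an admissible prime with (Br) for every non-CM-proxy `E` (it also records
  `E[p]` irreducible, which follows from surjectivity: tree `hasIrreducibleModPGaloisRep_of_hasSurjectiveModNGaloisRep`,
  not imported here to keep the cone light).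
* `stub_selmerUB` = `SelmerRankUB` VERBATIM (stmt-BirchSwinnertonDyer-0130): `s_p ≤ r_an`. The ONLY place the
  complex order enters (census §Verdict).
* `stub_shaPFinite` = `SelmerRankShaPFinite` VERBATIM (stmt-BirchSwinnertonDyer-0132, this route's item #5).
* `stub_schneider` = `PAdicOrderSchneiderR8` VERBATIM (stmt-BirchSwinnertonDyer-0536): Schneider's conjecture proper.
* `stub_factsCyclotomic` = the two named Literature facts `Schneider1985_order_charGenerator` (PRS / BMS 2016 Thm 1.7)
  ∧ `burungale_castella_skinner_charIdeal_eq_padicLFunction` (BCS 2025 Thm 1.1.2(a)) — printed theorems, librarian-grade.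
* `stub_modularity` = the named fact `exists_isNewformOf` (modularity; the sub's standing needs-fact).
* `stub_gsTotalDecayLeCycOrder` (theorem-grade, XL — the line's NEW work, height-free and `r_an`-free): at an admissible
  `p`, for the newform `f` of `E`: if `ord_T L_p(f, α_p, T) ≤ n` then the edge ratios of the Hida branch decay at rate
  `≤ n` along some slope `a/b < 1/2`. Mechanism: Greenberg–Stevens 1993 Thm 5.13/5.15 + Kitagawa 1994 (Delbourgo 2008
  Thm 4.11, Def 4.12, display p. 100): a bounded two-variable analytic `F` on the branch with `F(0,T) = c · L_p(E,T)`,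
  `c ≠ 0`, whose values at classical `(k,s)`, `(k,j)` (both odd) carry the SAME `𝕀`-adic period `Per⁺`, cancelling in the
  ratio; hence TOTAL order `n_p ≤ ord_T L_p(E,T) ≤ n`; generic slope (all but `≤ n_p` rational `μ`) + `dominantTerm`
  (PROVED below) turn total order into the rate `n_p (m+1) + O(1)`.

`EdgeDecay_of` composes them BY NAME through PROVED tree theorems: `stub_orderEqRankOfSchneiderShaAt` (Theorems/
LeadingTermPinchPrimeOrderEqRankOfSchneiderShaAt: facts + Ш[p^∞] finite + Schneider ⇒ `ord_T L_p = r_MW`),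
`exists_isCanonical_holds`, Greenberg's identity
`selmerCorank_eq_mordellWeilRank_add_holds` (`r_MW ≤ s_p`), and `stub_selmerUB` (`s_p ≤ r_an`).
Disproof used: none exists for this crux (crux dir had no Disproof.lean at registration). Census verdict: modulo printed
theorems EdgeDecay carries no content beyond UB ∧ Ш(p) ∧ Schneider (legs of SelmerRank / PAdicOrderV2 / LeadingTerm).
-/

set_option linter.dupNamespace false

namespace Summit.BirchSwinnertonDyer.BirchSwinnertonDyer.Cruxes.EdgeDecay.UbSchneiderSqueeze

open scoped Classical
open Filter Topology

/-- **Stub 1 — admissible-prime supply** (theorem-grade). [cite: Serre1981] -/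
theorem stub_admissibleSupply :
    ∀ (W : WeierstrassCurve ℚ) [W.IsElliptic] [W.IsGloballyMinimal], (∃ (p₀ : ℕ) (_ : Fact p₀.Prime), 5 ≤ p₀ ∧ W.HasGoodReductionAtPrime p₀ ∧ ¬ (p₀ : ℤ) ∣ W.frobeniusTrace p₀ ∧ W.HasSurjectiveModNGaloisRep p₀) → ∃ (_ : NeZero (W.conductorNorm ℤ)) (p : ℕ) (_ : Fact p.Prime), 5 ≤ p ∧ W.HasGoodReductionAtPrime p ∧ ¬ (p : ℤ) ∣ W.frobeniusTrace p ∧ ¬ (p : ℤ) ∣ (W.frobeniusTrace p) ^ 2 - 1 ∧ W.HasSurjectiveModNGaloisRep p ∧ W.HasIrreducibleModPGaloisRep p ∧ (∀ (M : ℕ) (_ : NeZero M) (g : CuspForm (CongruenceSubgroup.Gamma0 M) 2) (ι : Literature.NumberTheory.EllipticCurves.ModularForms.coeffField g →+* PadicAlgCl p), M ∣ W.conductorNorm ℤ * p → Literature.NumberTheory.EllipticCurves.ModularForms.IsNewform0 g → ‖ι ⟨(UpperHalfPlane.qExpansion 1 ⇑g).coeff p, Literature.NumberTheory.EllipticCurves.ModularForms.coeff_mem_coeffField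 g p⟩‖ = 1 → (∀ ℓ : ℕ, ℓ.Prime → ¬ ℓ ∣ W.conductorNorm ℤ * p → ‖ι ⟨(UpperHalfPlane.qExpansion 1 ⇑g).coeff ℓ, Literature.NumberTheory.EllipticCurves.ModularForms.coeff_mem_coeffField g ℓ⟩ - ((W.frobeniusTrace ℓ : ℤ) : PadicAlgCl p)‖ < 1) → M = W.conductorNorm ℤ ∧ ∀ n : ℕ, (UpperHalfPlane.qExpansion 1 ⇑g).coeff n = ((W.LFunction n : ℤ) : ℂ)) := by
  sorry

/-- **Stub 2 — `SelmerRankUB` verbatim** (stmt-BirchSwinnertonDyer-0130). [cite: Kato2004Asterisque, Thm 18.4] -/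
theorem stub_selmerUB :
    ∀ (W : WeierstrassCurve ℚ) [W.IsElliptic] [W.IsGloballyMinimal] (p : ℕ) [Fact p.Prime], 5 ≤ p → W.HasGoodReductionAtPrime p → ¬ (p : ℤ) ∣ W.frobeniusTrace p → W.HasSurjectiveModNGaloisRep p → W.selmerCorank p ≤ W.analyticRank := by
  sorry

/-- **Stub 3 — `SelmerRankShaPFinite` verbatim** (stmt-BirchSwinnertonDyer-0132). [cite: Kolyvagin1990] -/
theorem stub_shaPFinite :
    ∀ (W : WeierstrassCurve ℚ) [W.IsElliptic] (p : ℕ) [Fact p.Prime], Finite ↥(AddCommGroup.primaryComponent W.sha p) := by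
  sorry

/-- **Stub 4 — Schneider's conjecture proper, `PAdicOrderSchneiderR8` verbatim** (stmt-BirchSwinnertonDyer-0536).
[cite: MazurSteinTate2006, Conj. 1.1] -/
theorem stub_schneider :
    ∀ (W : WeierstrassCurve ℚ) [W.IsElliptic] [W.IsGloballyMinimal] (p : ℕ) [Fact p.Prime], 5 ≤ p → W.HasGoodReductionAtPrime p → ¬ (p : ℤ) ∣ W.frobeniusTrace p → ∀ D : WeierstrassCurve.PAdicHeightData W p, D.IsCanonical → WeierstrassCurve.SchneiderConjecture D := by
  sorry

/-- **Stub 5 — the two cyclotomic named facts** (printed theorems: Perrin-Riou–Schneider as in BMS 2016 Thm 1.7;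
Burungale–Castella–Skinner 2025 Thm 1.1.2(a)). [cite: BurungaleCastellaSkinner2025, Thm. 1.1.2 (a)] -/
theorem stub_factsCyclotomic :
    Literature.NumberTheory.EllipticCurves.Schneider1985_order_charGenerator ∧
      Literature.NumberTheory.EllipticCurves.burungale_castella_skinner_charIdeal_eq_padicLFunction := by
  sorry

/-- **Stub 6 — modularity** (the named fact `exists_isNewformOf`; Wiles–BCDT). [cite: DiamondShurman2005, Thm. 8.8.3] -/
theorem stub_modularity :
    Literature.NumberTheory.EllipticCurves.ModularForms.exists_isNewformOf := by
  sorry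

/-- **Stub 7 — two-variable total decay ≤ cyclotomic order** (theorem-grade, XL; Greenberg–Stevens/Kitagawa ratio
interpolation + generic slope + `dominantTerm`). [cite: GreenbergStevens1993, Thm 5.15] [cite: Delbourgo2008, Thm 4.11] -/
theorem stub_gsTotalDecayLeCycOrder :
    ∀ (W : WeierstrassCurve ℚ) [W.IsElliptic] [W.IsGloballyMinimal] (_ : NeZero (W.conductorNorm ℤ)) (p : ℕ) [Fact p.Prime], 5 ≤ p → W.HasGoodReductionAtPrime p → ¬ (p : ℤ) ∣ W.frobeniusTrace p → ¬ (p : ℤ) ∣ (W.frobeniusTrace p) ^ 2 - 1 → W.HasSurjectiveModNGaloisRep p → (∀ (M : ℕ) (_ : NeZero M) (g : CuspForm (CongruenceSubgroup.Gamma0 M) 2) (ι : Literature.NumberTheory.EllipticCurves.ModularForms.coeffField g →+* PadicAlgCl p), M ∣ W.conductorNorm ℤ * p → Literature.NumberTheory.EllipticCurves.ModularForms.IsNewform0 g → ‖ι ⟨(UpperHalfPlane.qExpansion 1 ⇑g).coeff p, Literature.NumberTheory.EllipticCurves.ModularForms.coeff_mem_coeffField g p⟩‖ = 1 → (∀ ℓ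 : ℕ, ℓ.Prime → ¬ ℓ ∣ W.conductorNorm ℤ * p → ‖ι ⟨(UpperHalfPlane.qExpansion 1 ⇑g).coeff ℓ, Literature.NumberTheory.EllipticCurves.ModularForms.coeff_mem_coeffField g ℓ⟩ - ((W.frobeniusTrace ℓ : ℤ) : PadicAlgCl p)‖ < 1) → M = W.conductorNorm ℤ ∧ ∀ n : ℕ, (UpperHalfPlane.qExpansion 1 ⇑g).coeff n = ((W.LFunction n : ℤ) : ℂ)) → ∀ (f : CuspForm (CongruenceSubgroup.Gamma0 (W.conductorNorm ℤ)) 2), Literature.NumberTheory.EllipticCurves.ModularForms.IsNewformOf W f → ∀ n : ℕ, (Literature.NumberTheory.EllipticCurves.padicLFunction f (Literature.NumberTheory.EllipticCurves.unitRoot W p : ℚ_[p])).order ≤ n → ∃ (a b : ℕ), 0 < b ∧ 2 * a < b ∧ ∀ J : ℕ, ∃ C : ℕ, ∀ m : ℕ, ∃ (k : ℤ) (g : CuspForm (CongruenceSubgroup.Gamma0 (W.conductorNorm ℤ)) k) (ι : Literature.NumberTheory.EllipticCurves.ModularForms.coeffField g →+* PadicAlgCl p) (s : ℕ), (2 * b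 * (p - 1) * p ^ m : ℤ) ∣ (k - 2) ∧ (2 * J + 3 : ℤ) ≤ k ∧ (b : ℤ) * ((s : ℤ) - 1) = a * (k - 2) ∧ Literature.NumberTheory.EllipticCurves.ModularForms.IsNewform0 g ∧ ‖ι ⟨(UpperHalfPlane.qExpansion 1 ⇑g).coeff p, Literature.NumberTheory.EllipticCurves.ModularForms.coeff_mem_coeffField g p⟩‖ = 1 ∧ (∀ ℓ : ℕ, ℓ.Prime → ¬ ℓ ∣ W.conductorNorm ℤ * p → ‖ι ⟨(UpperHalfPlane.qExpansion 1 ⇑g).coeff ℓ, Literature.NumberTheory.EllipticCurves.ModularForms.coeff_mem_coeffField g ℓ⟩ - ((W.frobeniusTrace ℓ : ℤ) : PadicAlgCl p)‖ < 1) ∧ ∀ (j : ℕ), Odd j → 3 ≤ j → j ≤ 2 * J + 1 → ∃ hR : (∫ t in Set.Ioi (0 : ℝ), ((t : ℂ) ^ (s - 1)) * g (UpperHalfPlane.ofComplex ((t : ℂ) * Complex.I))) / (∫ t in Set.Ioi (0 : ℝ), ((t : ℂ) ^ (j - 1)) * g (UpperHalfPlane.ofComplex ((t : ℂ) * Complex.I)))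 ∈ Literature.NumberTheory.EllipticCurves.ModularForms.coeffField g, 1 ≤ ‖ι ⟨_, hR⟩‖ * (p : ℝ) ^ (n * (m + 1) + C) := by
  sorry

/-- **First lemma of the line, PROVED (not a stub): dominant-term valuation growth.** For a strictly convergent
series `∑ aₙ κⁿ` on `ℤ_p` (`‖aₙ‖ → 0`) whose first non-zero coefficient is `a_d`, `‖∑ aₙ κⁿ‖ = ‖a_d‖ · ‖κ‖^d` as soon as
`v_p(κ) ≥ m₀`. Applied to `G(κ) = F(2+κ, 1+μκ)` along a generic slope `μ` (order `d = n_p`) it gives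
`v_p(G(k-2)) = n_p · (m+1) + O(1)` for `v_p(k-2) = m` — the exponent shape of the crux and of stub 7. [folklore] -/
theorem dominantTerm (p : ℕ) [Fact p.Prime] (a : ℕ → ℚ_[p])
    (ha : Tendsto (fun n => ‖a n‖) atTop (𝓝 0)) (d : ℕ) (hd : a d ≠ 0)
    (hlt : ∀ n < d, a n = 0) :
    ∃ m₀ : ℕ, ∀ κ : ℤ_[p], κ ≠ 0 → m₀ ≤ κ.valuation →
      ‖∑' n, a n * (κ : ℚ_[p]) ^ n‖ = ‖a d‖ * ‖(κ : ℚ_[p])‖ ^ d := by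
  have hp : Nat.Prime p := Fact.out
  have hp1 : (1 : ℝ) < p := by exact_mod_cast hp.one_lt
  have hp0 : (0 : ℝ) < p := by positivity
  -- the coefficients are bounded by some M > 0
  obtain ⟨M, hMpos, hM⟩ : ∃ M : ℝ, 0 < M ∧ ∀ n, ‖a n‖ ≤ M := by
    have ha' : Tendsto (fun n => ‖a n‖) cofinite (𝓝 0) := by rwa [Nat.cofinite_eq_atTop]
    obtain ⟨M, hM⟩ := ha'.bddAbove_range_of_cofinite
    refine ⟨max M 1, lt_of_lt_of_le one_pos (le_max_right _ _), fun n => ?_⟩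
    exact (hM ⟨n, rfl⟩).trans (le_max_left _ _)
  have had : 0 < ‖a d‖ := norm_pos_iff.mpr hd
  -- choose m₀ with 2 M p^{-m₀} < ‖a d‖ and m₀ ≥ 1
  obtain ⟨m₀, hm₀⟩ : ∃ m₀ : ℕ, 2 * M * (p : ℝ)⁻¹ ^ m₀ < ‖a d‖ := by
    have ht : Tendsto (fun m : ℕ => 2 * M * (p : ℝ)⁻¹ ^ m) atTop (𝓝 (2 * M * 0)) :=
      (tendsto_pow_atTop_nhds_zero_of_lt_one (by positivity) (inv_lt_one_of_one_lt₀ hp1)).const_mul _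
    rw [mul_zero] at ht
    exact (ht.eventually (gt_mem_nhds had)).exists
  refine ⟨m₀ + 1, fun κ hκ hv => ?_⟩
  set x : ℚ_[p] := (κ : ℚ_[p]) with hx
  -- ‖x‖ = p^{-v} ≤ p^{-(m₀+1)} < 1
  have hxnorm : ‖x‖ = (p : ℝ)⁻¹ ^ κ.valuation := by
    rw [hx, PadicInt.padic_norm_e_of_padicInt, PadicInt.norm_eq_zpow_neg_valuation hκ, inv_pow,
      ← zpow_natCast, ← zpow_neg]
  have hxle : ‖x‖ ≤ (p : ℝ)⁻¹ ^ (m₀ + 1) := by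
    rw [hxnorm]; exact pow_le_pow_of_le_one (by positivity) (inv_le_one_of_one_le₀ hp1.le) hv
  have hx1 : ‖x‖ < 1 := lt_of_le_of_lt hxle (pow_lt_one₀ (by positivity) (inv_lt_one_of_one_lt₀ hp1) (by omega))
  have hx0 : 0 ≤ ‖x‖ := norm_nonneg _
  -- summability of the series (geometric domination)
  have hsum : Summable fun n => a n * x ^ n := by
    refine Summable.of_norm_bounded (g := fun n => M * ‖x‖ ^ n) ((summable_geometric_of_lt_one hx0 hx1).mul_left M) ?_
    intro n
    rw [norm_mul, norm_pow]
    exact mul_le_mul_of_nonneg_right (hM n) (pow_nonneg hx0 _)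
  -- split off the first d+1 terms
  have hsplit := (hsum.sum_add_tsum_nat_add (d + 1)).symm
  have hfin : ∑ n ∈ Finset.range (d + 1), a n * x ^ n = a d * x ^ d := by
    rw [Finset.sum_range_succ, Finset.sum_eq_zero (fun n hn => ?_), zero_add]
    rw [hlt n (Finset.mem_range.mp hn), zero_mul]
  rw [hfin] at hsplit
  -- bound the tail: ‖T‖ ≤ 2 M ‖x‖^{d+1} < ‖a d‖ ‖x‖^d
  set T : ℚ_[p] := ∑' n, a (n + (d + 1)) * x ^ (n + (d + 1)) with hT
  have hTle : ‖T‖ ≤ 2 * M * ‖x‖ ^ (d + 1) := by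
    have hgeo : HasSum (fun n : ℕ => ‖x‖ ^ n) (1 - ‖x‖)⁻¹ := hasSum_geometric_of_lt_one hx0 hx1
    have h1 : ∀ n, ‖a (n + (d + 1)) * x ^ (n + (d + 1))‖ ≤ M * ‖x‖ ^ (d + 1) * ‖x‖ ^ n := by
      intro n
      rw [norm_mul, norm_pow, pow_add]
      calc ‖a (n + (d + 1))‖ * (‖x‖ ^ n * ‖x‖ ^ (d + 1))
          ≤ M * (‖x‖ ^ n * ‖x‖ ^ (d + 1)) := mul_le_mul_of_nonneg_right (hM _) (by positivity)
        _ = M * ‖x‖ ^ (d + 1) * ‖x‖ ^ n := by ring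
    have h2 : ‖T‖ ≤ M * ‖x‖ ^ (d + 1) * (1 - ‖x‖)⁻¹ :=
      tsum_of_norm_bounded (hgeo.mul_left (M * ‖x‖ ^ (d + 1))) h1
    have h4 : (1 - ‖x‖)⁻¹ ≤ 2 := by
      have hxhalf : ‖x‖ ≤ 1 / 2 := by
        refine hxle.trans ?_
        calc (p : ℝ)⁻¹ ^ (m₀ + 1) ≤ (p : ℝ)⁻¹ ^ 1 :=
              pow_le_pow_of_le_one (by positivity) (inv_le_one_of_one_le₀ hp1.le) (by omega)
          _ = (p : ℝ)⁻¹ := pow_one _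
          _ ≤ 1 / 2 := by
              rw [one_div]; exact inv_anti₀ (by norm_num) (by exact_mod_cast hp.two_le)
      rw [inv_le_comm₀ (by linarith) (by norm_num)]
      linarith
    calc ‖T‖ ≤ M * ‖x‖ ^ (d + 1) * (1 - ‖x‖)⁻¹ := h2
      _ ≤ M * ‖x‖ ^ (d + 1) * 2 := by gcongr
      _ = 2 * M * ‖x‖ ^ (d + 1) := by ring
  have hxne : x ≠ 0 := by rw [hx]; exact PadicInt.coe_ne_zero.mpr hκ
  have hpos : 0 < ‖x‖ := norm_pos_iff.mpr hxne
  have hTlt : ‖T‖ < ‖a d * x ^ d‖ := by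
    rw [norm_mul, norm_pow]
    calc ‖T‖ ≤ 2 * M * ‖x‖ ^ (d + 1) := hTle
      _ = (2 * M * ‖x‖) * ‖x‖ ^ d := by ring
      _ < ‖a d‖ * ‖x‖ ^ d := by
          apply mul_lt_mul_of_pos_right _ (pow_pos hpos _)
          calc 2 * M * ‖x‖ ≤ 2 * M * (p : ℝ)⁻¹ ^ (m₀ + 1) := by gcongr
            _ ≤ 2 * M * (p : ℝ)⁻¹ ^ m₀ :=
                mul_le_mul_of_nonneg_left
                  (pow_le_pow_of_le_one (by positivity) (inv_le_one_of_one_le₀ hp1.le) (Nat.le_succ _))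
                  (by positivity)
            _ < ‖a d‖ := hm₀
  -- ultrametric: ‖a_d x^d + T‖ = ‖a_d x^d‖
  rw [hsplit, Padic.add_eq_max_of_ne (ne_of_gt hTlt), max_eq_left hTlt.le, norm_mul,
    norm_pow]

/-- **Composition**: the crux `EdgeDecay` BY NAME from the seven registered stubs (used by name) and proved tree
theorems; the glue itself is bookkeeping + `r_MW (m+1) + C ≤ r_an (m+1) + C` (`r_MW ≤ s_p ≤ r_an`). -/
theorem EdgeDecay_of : Summit.BirchSwinnertonDyer.BirchSwinnertonDyer.Theses.TangentCone.EdgeDecay := by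
  intro W _ _ _h2 hp₀
  obtain ⟨hN, p, hp, h5, hgood, hord, hna, hsurj, hirr, hBr⟩ := stub_admissibleSupply W hp₀
  obtain ⟨hPRS, hBCS⟩ := stub_factsCyclotomic
  obtain ⟨f, hf⟩ := stub_modularity W
  have hordAt : Literature.NumberTheory.EllipticCurves.IsOrdinaryAt W p := ⟨hgood, hord⟩
  obtain ⟨Dh, hDh⟩ := WeierstrassCurve.exists_isCanonical_holds W p h5 hgood hord
  have hSch : WeierstrassCurve.SchneiderConjecture Dh := stub_schneider W p h5 hgood hord Dh hDh
  have hSha : Finite ↥(AddCommGroup.primaryComponent W.sha p) := stub_shaPFinite W p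
  have horder : (Literature.NumberTheory.EllipticCurves.padicLFunction f
      (Literature.NumberTheory.EllipticCurves.unitRoot W p : ℚ_[p])).order = W.mordellWeilRank :=
    Summit.BirchSwinnertonDyer.BirchSwinnertonDyer.Cruxes.PinchPrime.FirstLayerStability.stub_orderEqRankOfSchneiderShaAt
      hPRS hBCS W p h5 hordAt hirr hSha Dh hDh hSch f hf
  obtain ⟨a, b, hb, hab, hJ⟩ :=
    stub_gsTotalDecayLeCycOrder W hN p h5 hgood hord hna hsurj hBr f hf W.mordellWeilRank (le_of_eq horder)
  refine ⟨hN, p, hp, h5, hgood, hord, hna, hsurj, hBr, a, b, hb, hab, fun J => ?_⟩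
  obtain ⟨C, hm⟩ := hJ J
  refine ⟨C, fun m => ?_⟩
  obtain ⟨k, g, ι, s, hdiv, hkJ, hs, hnew, hordg, hcong, hall⟩ := hm m
  refine ⟨k, g, ι, s, hdiv, hkJ, hs, hnew, hordg, hcong, fun j hjodd hj3 hjJ => ?_⟩
  obtain ⟨hR, hlow⟩ := hall j hjodd hj3 hjJ
  refine ⟨hR, le_trans hlow ?_⟩
  have hId : W.selmerCorank p = W.mordellWeilRank + W.shaCorank p :=
    W.selmerCorank_eq_mordellWeilRank_add_holds p
  have hUB : W.selmerCorank p ≤ W.analyticRank := stub_selmerUB W p h5 hgood hord hsurj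
  have hle : W.mordellWeilRank ≤ W.analyticRank := by omega
  have hp1 : (1 : ℝ) ≤ (p : ℝ) := by exact_mod_cast hp.out.one_lt.le
  have hexp : W.mordellWeilRank * (m + 1) + C ≤ W.analyticRank * (m + 1) + C :=
    Nat.add_le_add_right (Nat.mul_le_mul_right _ hle) _
  exact mul_le_mul_of_nonneg_left (pow_le_pow_right₀ hp1 hexp) (norm_nonneg _)

end Summit.BirchSwinnertonDyer.BirchSwinnertonDyer.Cruxes.EdgeDecay.UbSchneiderSqueeze
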